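import Literature.NumberTheory.EllipticCurves.CongruenceNumber
import Literature.NumberTheory.EllipticCurves.ModularDegreeMinimal
import Literature.NumberTheory.EllipticCurves.ModularCurveManinSemistableBridgeProofs
import Literature.NumberTheory.EllipticCurves.SzpiroFreyConductorProofs
import Literature.NumberTheory.Automorphic.ShimuraCurveRibetTakahashiCokernelProofs
import Summits.ABC.ABC.Theses.DefiniteXi
import HarnessLib

/-!
# STUB-IDEAS k1 GEN 15 — sketch: the ONE-SIDED ARS input (`H5`) suffices for L6′

Stub-ideation seat `sidea-stmt-ABC-15024-stub_xiDegreeC-1` (k = 1, Family 1 RECOGNISE & IMPORT), gen 15.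
The g11 certificate (`STUB_IDEAS_stub_xiDegreeComparison_1_g11_Certificate.lean`) closes the registered stub
`stub_xiDegreeComparison` from `XiCongruenceComparison` (PROVED there) + the named fact
`padicValNat_congruenceNumber_eq_of_not_sq_dvd` (ARS 2012 Thm 2.1(b), an EQUALITY at every `p` with `p² ∤ N`)
+ `FreyModularity`, and ARS enters ONLY through `L6′ : cps(r_{D.f}) ≤ cps(deg D)`.

This file records the sharper trust base: `L6′` needs only the ONE-SIDED inequality
`ord_p(r_f) ≤ ord_p(m_E)` at primes `p ≥ 5` with `p² ∤ N` (`OneSidedARS`, below) — which is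
(i) the half of ARS Thm 2.1(b) proved in ARS §5 (Prop 5.4 + Lemma 5.5 + Prop 5.10, "multiplicity one for
differentials", p ∥ N allowed), and independently (ii) the multiplicity-one road ARS Prop 5.9 + Tilouine 1997
Thm 3.4 (Cornell–Silverman–Stevens p. 404–406) at non-Eisenstein `m`, which covers the Frey curve at every
`p ≥ 5` (Mazur–Kenku irreducibility).  `oneSidedARS_of_ARS` shows the named tree fact implies it, so nothing is lost.

All decls elaborate; proofs are copies of the certificate's L5/L6′ bookkeeping with `=` weakened to `≤`.
-/

set_option linter.dupNamespace false

noncomputable section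

namespace Summit.ABC.ABC.Cruxes.SteinbergCore.StubIdeasK1G15

open Literature.NumberTheory.EllipticCurves Literature.NumberTheory.EllipticCurves.ModularForms

/-- **H5 — the one-sided ARS input actually consumed by the stub** (`p ≥ 5`, `p² ∤ N`, `D` of minimal degree
among data with the same newform): `ord_p(r_{D.f}) ≤ ord_p(deg D)`.
[cite: AgasheRibetStein2012, Thm. 2.1(b) (one direction), Prop. 5.4, Lemma 5.5, Prop. 5.10; Prop. 5.9 +
Tilouine 1997 Thm. 3.4 for the multiplicity-one road] -/
def OneSidedARS : Prop :=
  ∀ (W : WeierstrassCurve ℚ) [W.IsElliptic] (N : ℕ) [NeZero N] (D : ModularParametrizationData W N),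
    (∀ (W' : WeierstrassCurve ℚ) [W'.IsElliptic] (D' : ModularParametrizationData W' N),
        D'.f = D.f → D.modularDegree ≤ D'.modularDegree) →
      ∀ p : ℕ, p.Prime → 5 ≤ p → ¬ p ^ 2 ∣ N →
        padicValNat p (congruenceNumber D.f) ≤ padicValNat p D.modularDegree

/-- The tree's named fact (ARS Thm 2.1(b), equality) implies the one-sided input. -/
theorem oneSidedARS_of_ARS (h : padicValNat_congruenceNumber_eq_of_not_sq_dvd) : OneSidedARS :=
  fun W _ N _ D hmin p hp _ hsq => (h W N D hmin p hp hsq).le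

/-- `2^{v₂ n} 3^{v₃ n} ∣ n`. -/
theorem ordProj_two_mul_ordProj_three_dvd (n : ℕ) : ordProj[2] n * ordProj[3] n ∣ n :=
  Nat.Coprime.mul_dvd_of_dvd_of_dvd (Nat.Coprime.pow _ _ (by norm_num)) (Nat.ordProj_dvd n 2)
    (Nat.ordProj_dvd n 3)

theorem primeToSix_ne_zero {n : ℕ} (hn : n ≠ 0) : n / (ordProj[2] n * ordProj[3] n) ≠ 0 :=
  (Nat.div_pos (Nat.le_of_dvd (Nat.pos_of_ne_zero hn) (ordProj_two_mul_ordProj_three_dvd n))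
    (Nat.pos_of_ne_zero (mul_ne_zero (pow_ne_zero _ two_ne_zero) (pow_ne_zero _ three_ne_zero)))).ne'

/-- Valuations of `cps n = n / (2^{v₂ n} 3^{v₃ n})`. -/
theorem factorization_primeToSix (n q : ℕ) :
    (n / (ordProj[2] n * ordProj[3] n)).factorization q =
      if q = 2 ∨ q = 3 then 0 else n.factorization q := by
  rw [Nat.factorization_div (ordProj_two_mul_ordProj_three_dvd n), Finsupp.tsub_apply,
    Nat.factorization_mul (pow_ne_zero _ two_ne_zero) (pow_ne_zero _ three_ne_zero),
    Finsupp.add_apply, Nat.prime_two.factorization_pow, Nat.prime_three.factorization_pow,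
    Finsupp.single_apply, Finsupp.single_apply]
  by_cases h2 : q = 2
  · subst h2; simp
  · by_cases h3 : q = 3
    · subst h3; simp
    · simp [h2, h3, Ne.symm h2, Ne.symm h3]

/-- `cps` bookkeeping: `v_p x ≤ v_p r + v_p e` for all primes `p ≥ 5` gives `cps x ≤ cps r · e`. -/
theorem primeToSix_le_mul_of_factorization_le {x r e : ℕ} (hr : r ≠ 0) (he : e ≠ 0)
    (h : ∀ p : ℕ, p.Prime → 5 ≤ p → x.factorization p ≤ r.factorization p + e.factorization p) :
    x / (ordProj[2] x * ordProj[3] x) ≤ r / (ordProj[2] r * ordProj[3] r) * e := by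
  rcases eq_or_ne x 0 with rfl | hx
  · simp
  have hcx := primeToSix_ne_zero hx
  have hcre : r / (ordProj[2] r * ordProj[3] r) * e ≠ 0 := mul_ne_zero (primeToSix_ne_zero hr) he
  refine Nat.le_of_dvd (Nat.pos_of_ne_zero hcre) ((Nat.factorization_le_iff_dvd hcx hcre).mp ?_)
  rw [Nat.factorization_mul (primeToSix_ne_zero hr) he]
  refine Finsupp.le_def.mpr fun q => ?_
  rw [Finsupp.add_apply, factorization_primeToSix, factorization_primeToSix]
  by_cases h23 : q = 2 ∨ q = 3
  · simp [h23]
  · rw [if_neg h23, if_neg h23]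
    by_cases hq : q.Prime
    · have h4 : q ≠ 4 := by rintro rfl; exact absurd hq (by decide)
      have h2q := hq.two_le
      push Not at h23
      exact h q hq (by omega)
    · simp [Nat.factorization_eq_zero_of_not_prime _ hq]

/-- `cps m ≤ cps n` for `m ∣ n ≠ 0`. -/
theorem primeToSix_le_of_dvd' {m n : ℕ} (h : m ∣ n) (hn : n ≠ 0) :
    m / (ordProj[2] m * ordProj[3] m) ≤ n / (ordProj[2] n * ordProj[3] n) := by
  have hm : m ≠ 0 := ne_zero_of_dvd_ne_zero hn h
  have hle := Finsupp.le_def.mp ((Nat.factorization_le_iff_dvd hm hn).mpr h)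
  have := primeToSix_le_mul_of_factorization_le (x := m) hn one_ne_zero
    (fun p _ _ => by simpa using hle p)
  simpa using this

/-- `q² ∤ N(E_(a,b))` at every odd prime `q`. -/
theorem not_sq_dvd_conductorNorm_freyCurve_of_ne_two {a b : ℤ} (hab : IsCoprime a b)
    (h0 : a * b * (a + b) ≠ 0) {q : ℕ} (hq : q.Prime) (hq2 : q ≠ 2) :
    ¬ q ^ 2 ∣ (freyCurve a b).conductorNorm ℤ := by
  intro hq2N
  have h' : q ^ 2 ∣ 2 ^ 8 * (UniqueFactorizationMonoid.radical (a * b * (a + b))).natAbs :=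
    hq2N.trans (conductorNorm_freyCurve_dvd_holds a b hab h0)
  have hcop : Nat.Coprime (q ^ 2) (2 ^ 8) :=
    Nat.Coprime.pow _ _ ((Nat.coprime_primes hq Nat.prime_two).mpr hq2)
  have hr : q ^ 2 ∣ (UniqueFactorizationMonoid.radical (a * b * (a + b))).natAbs :=
    hcop.dvd_of_dvd_mul_left h'
  have hsq : Squarefree (UniqueFactorizationMonoid.radical (a * b * (a + b))).natAbs :=
    Int.squarefree_natAbs.mpr UniqueFactorizationMonoid.squarefree_radical
  have hu : IsUnit (q : ℕ) := hsq q ((pow_two q) ▸ hr)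
  exact hq.ne_one (Nat.isUnit_iff.mp hu)

/-- **L6′ from the ONE-SIDED input (H5).**  For the Frey curve and ANY datum `D` at its conductor:
`cps(r_{D.f}) ≤ cps(deg D)` — same proof as the certificate's L6′ with `=` replaced by `≤`. -/
theorem primeToSix_congruenceNumber_le_primeToSix_deg_of_oneSided (hARS : OneSidedARS)
    {a b : ℤ} (hab : IsCoprime a b) (h0 : a * b * (a + b) ≠ 0) {N : ℕ} [NeZero N]
    (hN : (freyCurve a b).conductorNorm ℤ = N) (D : ModularParametrizationData (freyCurve a b) N) :
    congruenceNumber D.f / (ordProj[2] (congruenceNumber D.f) * ordProj[3] (congruenceNumber D.f)) ≤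
      D.deg / (ordProj[2] D.deg * ordProj[3] D.deg) := by
  haveI := isElliptic_freyCurve h0
  obtain ⟨W₀, hW₀, D₀, hf₀, h₀⟩ := D.exists_optimalDatum'
  haveI := hW₀
  have hker₀ : D₀.isogenyMap.ker = ⊥ := D₀.isogenyMap_ker_eq_bot_iff.mpr h₀
  have hmin₀ : ∀ (W₂ : WeierstrassCurve ℚ) [W₂.IsElliptic] (D₂ : ModularParametrizationData W₂ N),
      D₂.f = D₀.f → D₀.modularDegree ≤ D₂.modularDegree := fun W₂ _ D₂ hD₂ =>
    D₀.modularDegree_le_of_isogenyMap_ker_eq_bot hker₀ D₂ hD₂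
  have hdvd : D₀.modularDegree ∣ D.deg := by
    have hinj : Function.Injective D₀.isogenyMap := (AddMonoidHom.ker_eq_bot_iff _).mp hker₀
    obtain ⟨_, hdeg⟩ := D.modularDegree_eq_card_ker_mul hf₀.symm D₀.smul_periodLattice_le hinj
      D₀.deg_pos D₀.finite_setOf_natCard_fiberOrbits_ne
    exact ⟨_, hdeg.trans (mul_comm _ _)⟩
  have hd0 : D₀.modularDegree ≠ 0 := D₀.deg_pos.ne'
  have hval : ∀ p : ℕ, p.Prime → 5 ≤ p → (congruenceNumber D.f).factorization p ≤
      D₀.modularDegree.factorization p + (1 : ℕ).factorization p := by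
    intro p hp h5
    have hsq : ¬ p ^ 2 ∣ N := by
      have h := not_sq_dvd_conductorNorm_freyCurve_of_ne_two hab h0 hp (by omega)
      rwa [hN] at h
    have h := hARS W₀ N D₀ hmin₀ p hp h5 hsq
    rw [hf₀, ← Nat.factorization_def _ hp, ← Nat.factorization_def _ hp] at h
    simpa using h
  calc congruenceNumber D.f / (ordProj[2] (congruenceNumber D.f) * ordProj[3] (congruenceNumber D.f))
      ≤ D₀.modularDegree / (ordProj[2] D₀.modularDegree * ordProj[3] D₀.modularDegree) * 1 :=
        primeToSix_le_mul_of_factorization_le hd0 one_ne_zero hval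
    _ = D₀.modularDegree / (ordProj[2] D₀.modularDegree * ordProj[3] D₀.modularDegree) := mul_one _
    _ ≤ D.deg / (ordProj[2] D.deg * ordProj[3] D.deg) := primeToSix_le_of_dvd' hdvd D.deg_pos.ne'


/-! ## Part 2 — the registered stub from `XiCongruenceComparison` (PROVED in the g11 certificate) + H5 + modularity

`XiCongruenceComparison` is copied VERBATIM from the g11 certificate (`StubIdeasK1G11.XiCongruenceComparison`, proved there
unconditionally as `xiCongruenceComparison`; crux workfiles are not importable, hence a hypothesis here).  The assembly below is the
certificate's `stub_of_xiCongruenceComparison` with the single `hARS` use re-pointed at the one-sided `L6′`. -/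

open scoped MatrixGroups ModularForm
open CongruenceSubgroup
open Literature.NumberTheory.Automorphic

/-- Child 1♮ of the g11 certificate, verbatim: `cps ξ ≤ C_ε N^ε · cps(r_f)` for every newform `f` of the Frey curve. -/
def XiCongruenceComparison : Prop :=
  ∀ ε : ℝ, 0 < ε → ∃ C : ℝ, ∀ a b : ℤ, IsCoprime a b → a * b * (a + b) ≠ 0 → ∀ (N : ℕ) [NeZero N],
    (freyCurve a b).conductorNorm ℤ = N →
    ∀ Nm : ℕ, Odd Nm → Squarefree Nm → Odd Nm.primeFactors.card → Nm ∣ N →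
    brandtXi (N / Nm) Nm (fun n => (freyCurve a b).LFunction n) ≠ 0 →
    ∀ f : CuspForm (Gamma0 N) 2, IsNewformOf (freyCurve a b) f →
      ((brandtXi (N / Nm) Nm (fun n => (freyCurve a b).LFunction n) /
          (ordProj[2] (brandtXi (N / Nm) Nm (fun n => (freyCurve a b).LFunction n)) *
            ordProj[3] (brandtXi (N / Nm) Nm (fun n => (freyCurve a b).LFunction n))) : ℕ) : ℝ) ≤
        C * (N : ℝ) ^ ε *
          ((congruenceNumber f / (ordProj[2] (congruenceNumber f) * ordProj[3] (congruenceNumber f)) : ℕ) : ℝ)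

/-- **The REGISTERED stub (verbatim `stub_xiDegreeComparison` of `Lines/p6_tamagawa_split.lean`) from
`XiCongruenceComparison` + the ONE-SIDED ARS input `OneSidedARS` + `FreyModularity`.** -/
theorem stub_of_xiCongruenceComparison_oneSided (h1 : XiCongruenceComparison) (hARS : OneSidedARS)
    (hMod : Summit.ABC.ABC.Theses.DefiniteXi.FreyModularity) :
    ∀ ε : ℝ, 0 < ε → ∃ C : ℝ, ∀ a b : ℤ, IsCoprime a b → a * b * (a + b) ≠ 0 → ∀ (N : ℕ) [NeZero N],
      (Literature.NumberTheory.EllipticCurves.freyCurve a b).conductorNorm ℤ = N →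
      ∀ Nm : ℕ, Odd Nm → Squarefree Nm → Odd Nm.primeFactors.card → Nm ∣ N →
      Literature.NumberTheory.Automorphic.brandtXi (N / Nm) Nm
          (fun n => (Literature.NumberTheory.EllipticCurves.freyCurve a b).LFunction n) ≠ 0 →
      ∃ D : Literature.NumberTheory.EllipticCurves.ModularForms.ModularParametrizationData
        (Literature.NumberTheory.EllipticCurves.freyCurve a b) N,
        (∀ D' : Literature.NumberTheory.EllipticCurves.ModularForms.ModularParametrizationData
          (Literature.NumberTheory.EllipticCurves.freyCurve a b) N, D.deg ≤ D'.deg) ∧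
        ((Literature.NumberTheory.Automorphic.brandtXi (N / Nm) Nm
              (fun n => (Literature.NumberTheory.EllipticCurves.freyCurve a b).LFunction n) /
            (ordProj[2] (Literature.NumberTheory.Automorphic.brandtXi (N / Nm) Nm
                (fun n => (Literature.NumberTheory.EllipticCurves.freyCurve a b).LFunction n)) *
              ordProj[3] (Literature.NumberTheory.Automorphic.brandtXi (N / Nm) Nm
                (fun n => (Literature.NumberTheory.EllipticCurves.freyCurve a b).LFunction n))) : ℕ) : ℝ) ≤
          C * (N : ℝ) ^ ε * ((D.deg / (ordProj[2] D.deg * ordProj[3] D.deg) : ℕ) : ℝ) *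
            ((∏ q ∈ N.primeFactors, ((Literature.NumberTheory.EllipticCurves.freyCurve a b).minimalDiscriminantNorm
              ℤ).factorization q : ℕ) : ℝ) ^ 3 := by
  intro ε hε
  obtain ⟨C, hC⟩ := h1 ε hε
  refine ⟨max C 0, fun a b hab h0 N _ hN Nm hodd hsq hcard hNmN hξ => ?_⟩
  haveI := isElliptic_freyCurve h0
  obtain ⟨D, -, hDmin⟩ := exists_minimal_datum (hMod a b hab h0 N hN)
  refine ⟨D, fun D' => hDmin D', ?_⟩
  set ξ : ℕ := brandtXi (N / Nm) Nm (fun n => (freyCurve a b).LFunction n) with hξdef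
  set T : ℕ := ∏ q ∈ N.primeFactors, ((freyCurve a b).minimalDiscriminantNorm ℤ).factorization q with hTdef
  set r : ℕ := congruenceNumber D.f with hr
  have hcmp : ((ξ / (ordProj[2] ξ * ordProj[3] ξ) : ℕ) : ℝ) ≤
      C * (N : ℝ) ^ ε * ((r / (ordProj[2] r * ordProj[3] r) : ℕ) : ℝ) :=
    hC a b hab h0 N hN Nm hodd hsq hcard hNmN hξ D.f D.isNewformOf
  have hL6 : ((r / (ordProj[2] r * ordProj[3] r) : ℕ) : ℝ) ≤
      ((D.deg / (ordProj[2] D.deg * ordProj[3] D.deg) : ℕ) : ℝ) := by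
    exact_mod_cast primeToSix_congruenceNumber_le_primeToSix_deg_of_oneSided hARS hab h0 hN D
  have hone : ∀ q ∈ N.primeFactors, 1 ≤ ((freyCurve a b).minimalDiscriminantNorm ℤ).factorization q :=
    fun q hq => factorization_minimalDiscriminantNorm_pos_of_dvd (freyCurve a b)
      (Nat.prime_of_mem_primeFactors hq) (hN ▸ Nat.dvd_of_mem_primeFactors hq)
  have hT1 : (1 : ℝ) ≤ (T : ℝ) := by
    have : 1 ≤ T := Finset.one_le_prod' fun q hq => hone q hq
    exact_mod_cast this
  have hT3 : (1 : ℝ) ≤ (T : ℝ) ^ 3 := one_le_pow₀ hT1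
  have hNε : (0 : ℝ) ≤ (N : ℝ) ^ ε := by positivity
  calc ((ξ / (ordProj[2] ξ * ordProj[3] ξ) : ℕ) : ℝ)
      ≤ C * (N : ℝ) ^ ε * ((r / (ordProj[2] r * ordProj[3] r) : ℕ) : ℝ) := hcmp
    _ ≤ max C 0 * (N : ℝ) ^ ε * ((r / (ordProj[2] r * ordProj[3] r) : ℕ) : ℝ) := by
        have h0' : (0 : ℝ) ≤ (N : ℝ) ^ ε * ((r / (ordProj[2] r * ordProj[3] r) : ℕ) : ℝ) := by positivity
        calc C * (N : ℝ) ^ ε * ((r / (ordProj[2] r * ordProj[3] r) : ℕ) : ℝ)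
            = C * ((N : ℝ) ^ ε * ((r / (ordProj[2] r * ordProj[3] r) : ℕ) : ℝ)) := by ring
          _ ≤ max C 0 * ((N : ℝ) ^ ε * ((r / (ordProj[2] r * ordProj[3] r) : ℕ) : ℝ)) :=
              mul_le_mul_of_nonneg_right (le_max_left _ _) h0'
          _ = _ := by ring
    _ ≤ max C 0 * (N : ℝ) ^ ε * ((D.deg / (ordProj[2] D.deg * ordProj[3] D.deg) : ℕ) : ℝ) := by gcongr
    _ = max C 0 * (N : ℝ) ^ ε * ((D.deg / (ordProj[2] D.deg * ordProj[3] D.deg) : ℕ) : ℝ) * 1 := by ring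
    _ ≤ max C 0 * (N : ℝ) ^ ε * ((D.deg / (ordProj[2] D.deg * ordProj[3] D.deg) : ℕ) : ℝ) * (T : ℝ) ^ 3 := by
        gcongr

/-! ## Audit -/
#print axioms oneSidedARS_of_ARS
#print axioms primeToSix_congruenceNumber_le_primeToSix_deg_of_oneSided
#print axioms stub_of_xiCongruenceComparison_oneSided

end Summit.ABC.ABC.Cruxes.SteinbergCore.StubIdeasK1G15

end
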